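import Literature.Probability.RandomPlanarGeometry.TwoSidedMultiplicity
import HarnessLib

/-!
# Two-sided paths as rooted one-sided paths; translation; the first step of an escape

Eighth proof file of the `PlaneNonIntersection` story (named fact
`LSW2001_srw_nonIntersection_five_eighths`, `PlaneNonIntersection.lean`), fifth input of the
`k^{-1/2}` programme (Lawler 1991, (3.29) via §3.6). Lawler's two-sided path
`W = (S² reversed, S³)` of lengths `(t₂, t₃)` rooted at `W(0) = 0` is, after translating its left
end to the origin, a one-sided path `Γ` of length `t₂ + t₃` with a marked root `Γ(t₂)`; this is the
dictionary between the two-sided sums of `TwoSidedMultiplicity.lean` and the rooted sums of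
`TwoSidedEscapeIdentity.lean`:

* `psi α β = Fin.append (revNeg α) β` (`revNeg` = reverse the order and the signs of the steps),
  a bijection `StepSeq 2 t₂ × StepSeq 2 t₃ ≃ StepSeq 2 (t₂ + t₃)` (`psiEquiv`), with
  `psi(i) = α(t₂ - i) - α(t₂)` (`i ≤ t₂`), `psi(t₂ + i) = β(i) - α(t₂)` (`pos_psi_left/right`), so
  `verts (psi α β) = (verts α ∪ verts β) - α(t₂)` (`verts_psi`) and "`β` does not return to `0`" iff
  "`t₂` is the last visit of `psi α β` to its root" ;
* translation invariance of the escape probabilities (`escProb_add_image`);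
* **the bridge** (`sum_sum_noRet_escProb_eq`):
  `Σ_{α} Σ_{β ∈ noRet t₃} q_n(0; verts α ∪ verts β) = Σ_{Γ : last visit at t₂} q_n(Γ(t₂); verts Γ)`;
* the first step of an escape from the root (`card_escSet_stepVec_le`): for `e_v ∉ A`,
  `#escSet (k+1) e_v A ≤ 4 #escSet (k+1) 0 A` (prefix the step `v`, then drop the last step).

All folklore bookkeeping; no estimate is proved in this file.

## References

* G. F. Lawler, *Intersections of Random Walks*, Birkhäuser 1991, §3.5–3.6 (two-sided walks)
  [Lawler1991].
-/

noncomputable section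

open Finset Real Literature.Probability.LatticeModels Literature.Probability.LatticeModels.SRW
open scoped BigOperators

namespace Literature.Probability.RandomPlanarGeometry

namespace PlaneNonIntersection

/-! ### Prefixing a step -/

/-- Prefixing a step `v`: `(v·β)(i+1) = e_v + β(i)`. [folklore] -/
theorem pos_cons_succ {t : ℕ} (v : Dir 2) (β : StepSeq 2 t) :
    ∀ i, i ≤ t → pos (Fin.cons v β : StepSeq 2 (t + 1)) (i + 1) = stepVec v + pos β i
  | 0, _ => by
      rw [show (0 : ℕ) + 1 = 0 + 1 from rfl, pos_succ _ (Nat.succ_pos t), pos_zero, pos_zero,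
        zero_add, add_zero]
      rfl
  | i + 1, hi => by
      have h : i < t := hi
      rw [pos_succ _ (by omega : i + 1 < t + 1), pos_cons_succ v β i h.le, pos_succ β h, add_assoc]
      congr 2

/-! ### Reverse-negate and the two-sided ↔ rooted one-sided dictionary -/

section Psi

variable {t₂ t₃ : ℕ}

/-- Reverse the order and the signs of the steps. [folklore] -/
def revNeg (α : StepSeq 2 t₂) : StepSeq 2 t₂ := fun i => (α (Fin.rev i)).neg

/-- `revNeg` is an involution. [folklore] -/
theorem revNeg_revNeg (α : StepSeq 2 t₂) : revNeg (revNeg α) = α := by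
  funext i
  simp [revNeg, Fin.rev_rev]

/-- Positions of the reversed-negated walk: `(revNeg α)(i) = α(t₂ - i) - α(t₂)`. [folklore] -/
theorem pos_revNeg (α : StepSeq 2 t₂) : ∀ i, i ≤ t₂ → pos (revNeg α) i = pos α (t₂ - i) - pos α t₂
  | 0, _ => by rw [pos_zero, Nat.sub_zero, sub_self]
  | i + 1, hi => by
      have h : i < t₂ := hi
      rw [pos_succ _ h, pos_revNeg α i h.le]
      have h2 : pos α (t₂ - i) = pos α (t₂ - (i + 1)) + stepVec (α ⟨t₂ - (i + 1), by omega⟩) := by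
        have := pos_succ α (by omega : t₂ - (i + 1) < t₂)
        rw [show t₂ - (i + 1) + 1 = t₂ - i by omega] at this
        exact this
      rw [h2]
      have h3 : stepVec (revNeg α ⟨i, h⟩) = -stepVec (α ⟨t₂ - (i + 1), by omega⟩) := by
        rw [revNeg, stepVec_neg]
        rfl
      rw [h3]
      abel

/-- The rooted one-sided path of a two-sided path: the left half reversed and negated, followed by
the right half. [folklore] -/
def psi (α : StepSeq 2 t₂) (β : StepSeq 2 t₃) : StepSeq 2 (t₂ + t₃) := Fin.append (revNeg α) β

/-- `psi` is a bijection `StepSeq 2 t₂ × StepSeq 2 t₃ ≃ StepSeq 2 (t₂ + t₃)`. [folklore] -/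
def psiEquiv (t₂ t₃ : ℕ) : StepSeq 2 t₂ × StepSeq 2 t₃ ≃ StepSeq 2 (t₂ + t₃) :=
  (Equiv.prodCongr (Function.Involutive.toPerm (revNeg (t₂ := t₂)) revNeg_revNeg) (Equiv.refl _)).trans
    (Fin.appendEquiv t₂ t₃)

/-- `psiEquiv` is `psi`. [folklore] -/
@[simp] theorem psiEquiv_apply (p : StepSeq 2 t₂ × StepSeq 2 t₃) : psiEquiv t₂ t₃ p = psi p.1 p.2 := rfl

/-- Left positions of `psi`: `psi(i) = α(t₂ - i) - α(t₂)` for `i ≤ t₂`. [folklore] -/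
theorem pos_psi_left (α : StepSeq 2 t₂) (β : StepSeq 2 t₃) :
    ∀ i, i ≤ t₂ → pos (psi α β) i = pos α (t₂ - i) - pos α t₂
  | 0, _ => by rw [pos_zero, Nat.sub_zero, sub_self]
  | i + 1, hi => by
      have h : i < t₂ := hi
      rw [pos_succ _ (by omega : i < t₂ + t₃), pos_psi_left α β i h.le]
      have hstep : (psi α β) ⟨i, by omega⟩ = revNeg α ⟨i, h⟩ := by
        have e : (⟨i, by omega⟩ : Fin (t₂ + t₃)) = Fin.castAdd t₃ ⟨i, h⟩ := rfl
        rw [psi, e, Fin.append_left]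
      rw [hstep, ← pos_revNeg α i h.le, ← pos_succ _ h, pos_revNeg α (i + 1) hi]

/-- Right positions of `psi`: `psi(t₂ + i) = β(i) - α(t₂)` for `i ≤ t₃`. [folklore] -/
theorem pos_psi_right (α : StepSeq 2 t₂) (β : StepSeq 2 t₃) :
    ∀ i, i ≤ t₃ → pos (psi α β) (t₂ + i) = pos β i - pos α t₂
  | 0, _ => by rw [add_zero, pos_psi_left α β t₂ le_rfl, Nat.sub_self, pos_zero, pos_zero]
  | i + 1, hi => by
      have h : i < t₃ := hi
      rw [show t₂ + (i + 1) = t₂ + i + 1 by ring, pos_succ _ (by omega : t₂ + i < t₂ + t₃),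
        pos_psi_right α β i h.le, pos_succ β h]
      have hstep : (psi α β) ⟨t₂ + i, by omega⟩ = β ⟨i, h⟩ := by
        have e : (⟨t₂ + i, by omega⟩ : Fin (t₂ + t₃)) = Fin.natAdd t₂ ⟨i, h⟩ := rfl
        rw [psi, e, Fin.append_right]
      rw [hstep]
      abel

/-- The vertex set of `psi α β` is the translate by `-α(t₂)` of `verts α ∪ verts β`. [folklore] -/
theorem verts_psi (α : StepSeq 2 t₂) (β : StepSeq 2 t₃) :
    verts (psi α β) = (verts α ∪ verts β).image fun x => x - pos α t₂ := by
  ext x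
  rw [mem_verts, Finset.mem_image]
  constructor
  · rintro ⟨j, hj, rfl⟩
    by_cases hjt : j ≤ t₂
    · exact ⟨pos α (t₂ - j), Finset.mem_union_left _ (pos_mem_verts α (Nat.sub_le _ _)),
        (pos_psi_left α β j hjt).symm⟩
    · refine ⟨pos β (j - t₂), Finset.mem_union_right _ (pos_mem_verts β (by omega)), ?_⟩
      rw [← pos_psi_right α β (j - t₂) (by omega), show t₂ + (j - t₂) = j by omega]
  · rintro ⟨y, hy, rfl⟩
    rw [Finset.mem_union, mem_verts, mem_verts] at hy
    rcases hy with ⟨j, hj, rfl⟩ | ⟨j, hj, rfl⟩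
    · refine ⟨t₂ - j, by omega, ?_⟩
      rw [pos_psi_left α β (t₂ - j) (Nat.sub_le _ _), show t₂ - (t₂ - j) = j by omega]
    · exact ⟨t₂ + j, by omega, pos_psi_right α β j hj⟩

/-- `t₂` is the last visit of `psi α β` to its root iff `β` does not return to its start.
[folklore] -/
theorem lastVisit_psi_iff (α : StepSeq 2 t₂) (β : StepSeq 2 t₃) :
    (∀ j' ≤ t₂ + t₃, t₂ < j' → pos (psi α β) j' ≠ pos (psi α β) t₂) ↔ β ∈ noRet t₃ := by
  rw [mem_noRet]
  have hroot : pos (psi α β) t₂ = -pos α t₂ := by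
    rw [pos_psi_left α β t₂ le_rfl, Nat.sub_self, pos_zero, zero_sub]
  constructor
  · intro h i hi h0
    have h1 := h (t₂ + (i + 1)) (by omega) (by omega)
    rw [pos_psi_right α β (i + 1) (by omega), h0, hroot, zero_sub] at h1
    exact h1 rfl
  · intro h j' hj' hlt heq
    have h1 := h (j' - t₂ - 1) (by omega)
    rw [show j' - t₂ - 1 + 1 = j' - t₂ by omega] at h1
    have h2 := pos_psi_right α β (j' - t₂) (by omega)
    rw [show t₂ + (j' - t₂) = j' by omega, heq, hroot] at h2
    have : pos β (j' - t₂) = 0 := by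
      have := congrArg (fun x => x + pos α t₂) h2
      simpa using this.symm
    exact h1 this

end Psi

/-! ### Translation invariance of escape probabilities -/

/-- Escaping a translated obstacle from the translated start is escaping the obstacle.
[folklore] -/
theorem escSet_add_image (m : ℕ) (y c : Site 2) (A : Finset (Site 2)) :
    escSet m (y + c) (A.image fun x => x + c) = escSet m y A := by
  ext ω
  rw [mem_escSet, mem_escSet]
  refine forall₂_congr fun i _ => not_congr ?_
  rw [Finset.mem_image]
  constructor
  · rintro ⟨x, hx, h⟩
    have : x = y + pos ω (i + 1) := by
      have := congrArg (fun z => z - c) h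
      simp only [add_sub_cancel_right] at this
      rw [this]
      abel
    rw [← this]
    exact hx
  · intro h
    exact ⟨y + pos ω (i + 1), h, by abel⟩

/-- `q_m(y + c; A + c) = q_m(y; A)`. [folklore] -/
theorem escProb_add_image (m : ℕ) (y c : Site 2) (A : Finset (Site 2)) :
    escProb m (y + c) (A.image fun x => x + c) = escProb m y A := by
  rw [escProb, escProb, escSet_add_image]

/-! ### The bridge between two-sided and rooted one-sided sums -/

/-- **The bridge**: summing the escape probability from the root over the two-sided paths whose
right half does not return equals summing, over the rooted one-sided paths of length `t₂ + t₃`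
whose root `t₂` is a last visit, the escape probability from the root.
[folklore] -/
theorem sum_sum_noRet_escProb_eq (n t₂ t₃ : ℕ) :
    ∑ α : StepSeq 2 t₂, ∑ β ∈ noRet t₃, escProb n 0 (verts α ∪ verts β) =
      ∑ Γ ∈ (Finset.univ : Finset (StepSeq 2 (t₂ + t₃))).filter
          (fun Γ => ∀ j' ≤ t₂ + t₃, t₂ < j' → pos Γ j' ≠ pos Γ t₂),
        escProb n (pos Γ t₂) (verts Γ) := by
  classical
  rw [show (∑ α : StepSeq 2 t₂, ∑ β ∈ noRet t₃, escProb n 0 (verts α ∪ verts β)) =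
      ∑ p ∈ (Finset.univ : Finset (StepSeq 2 t₂)) ×ˢ noRet t₃, escProb n 0 (verts p.1 ∪ verts p.2)
    from (Finset.sum_product Finset.univ (noRet t₃)
      (fun p : StepSeq 2 t₂ × StepSeq 2 t₃ => escProb n 0 (verts p.1 ∪ verts p.2))).symm]
  refine Finset.sum_equiv (psiEquiv t₂ t₃) (fun p => ?_) (fun p _ => ?_)
  · obtain ⟨α, β⟩ := p
    simp only [Finset.mem_product, Finset.mem_univ, true_and, Finset.mem_filter, psiEquiv_apply]
    exact (lastVisit_psi_iff α β).symm
  · obtain ⟨α, β⟩ := p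
    rw [psiEquiv_apply]
    dsimp only
    rw [verts_psi, pos_psi_left α β t₂ le_rfl, Nat.sub_self, pos_zero, zero_sub]
    have h := escProb_add_image n 0 (-pos α t₂) (verts α ∪ verts β)
    rw [zero_add] at h
    have hfun : (fun x : Site 2 => x - pos α t₂) = fun x => x + -pos α t₂ :=
      funext fun x => sub_eq_add_neg x _
    rw [hfun]
    exact h.symm

/-! ### The first step of an escape from the root -/

/-- Prefixing the step `v` embeds the `k`-step escapes from `e_v` into the `(k+1)`-step escapes from
`0`, when `e_v ∉ A`. [folklore] -/
theorem card_escSet_le_card_escSet_succ (k : ℕ) (v : Dir 2) (A : Finset (Site 2))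
    (hv : stepVec v ∉ A) : #(escSet k (stepVec v) A) ≤ #(escSet (k + 1) 0 A) := by
  refine Finset.card_le_card_of_injOn (fun β => (Fin.cons v β : StepSeq 2 (k + 1))) ?_ ?_
  · intro β hβ
    rw [Finset.mem_coe, mem_escSet] at hβ
    rw [Finset.mem_coe, mem_escSet]
    intro i hi
    rw [zero_add]
    rcases Nat.eq_zero_or_pos i with rfl | hpos
    · rw [pos_cons_succ v β 0 (Nat.zero_le k), pos_zero, add_zero]
      exact hv
    · obtain ⟨i', rfl⟩ : ∃ i', i = i' + 1 := ⟨i - 1, by omega⟩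
      rw [pos_cons_succ v β (i' + 1) (by omega)]
      exact hβ i' (by omega)
  · intro β _ β' _ h
    have h' := congrArg Fin.tail h
    simpa only [Fin.tail_cons] using h'

/-- **The first step of an escape**: for `e_v ∉ A`, `#escSet (k+1) e_v A ≤ 4 #escSet (k+1) 0 A`
(escape from `e_v` for `k` steps after the first step `v` from `0`, and drop the last step).
[folklore] -/
theorem card_escSet_stepVec_le (k : ℕ) (v : Dir 2) (A : Finset (Site 2)) (hv : stepVec v ∉ A) :
    #(escSet (k + 1) (stepVec v) A) ≤ 4 * #(escSet (k + 1) 0 A) :=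
  (card_escSet_succ_le k (stepVec v) A).trans
    (Nat.mul_le_mul_left 4 (card_escSet_le_card_escSet_succ k v A hv))

end PlaneNonIntersection

end Literature.Probability.RandomPlanarGeometry

end
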